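import Summits.NavierStokesRegularity.NavierStokesRegularity.Theses.ExtremiserTransience
import Summits.NavierStokesRegularity.NavierStokesRegularity.Theorems.ExtremiserTransienceSliceConstantSpeed
import Summits.NavierStokesRegularity.NavierStokesRegularity.Theorems.ExtremiserTransienceBallMassLower
import HarnessLib

/-!
# Route `ExtremiserTransience`, LINE g5-α repair (seat ns-idea-5 g5): item 27823 `PlateauSliceRigidity` from a SUBCUBIC local energy budget

`--supports stmt-NavierStokesRegularity-27823`.  Sharpening of `plateauSliceRigidity_of_budget` (p636343, budget `≤ C ρ²`): since the plateau slice
has mass `≥ c ρ³` on `B(0,ρ)` (`ballMassLower`, after `sliceConstantSpeed`), ANY subcubic budget `∫_{B(0,ρ)} ‖W(t₀)‖² ≤ C ρ^α`, `α < 3`, `ρ ≥ 1`,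
for the weak one-slice class already refutes it.  WHY THIS MATTERS (recipe for the budget prover, all engines in the tree): by
`weakClass_exists_classical_window` (p639292) a class member carries a classical pressure on every window, so the integrated local energy identity
`IsClassicalNSSolutionOn.local_energy_identity_cutoff` applies with a spatial cutoff of `B_ρ ⊂ B_{2ρ}` on the window `(t₀ − ρ², t₀)`; the Type-I bound
`‖W(σ)‖ ≤ K/√(−σ)` makes the initial term `O(ρ)`, the `Δφ` term `O(ρ log ρ)`, the cubic flux `O(ρ² (−t₀)^{−1/2})`; for the pressure flux the pressure
is `pressurePotentialMod x₀ (W σ) + c(σ)` (`pressure_eq_pressurePotentialMod_add_const_of_oseenMild`; the gauge `c(σ)` drops out because `div W = 0`),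
and the tree's POINTWISE oscillation bound `exists_abs_pressurePotentialMod_sub_le` (`|Q̃(x) − Q̃(x')| ≤ 2N_G ∫|Γ₀| + A N² √(1+|x−x'|)` with
`N = K/√(−σ)`, `N_G ≲ K₁²/(−σ)²` from the landed gradient bound `weakClass_gradTypeI`) gives the pressure flux `O(ρ^{5/2})` — subcubic, which by the
present theorem is enough (the `O(ρ²)` form would need the `L^{3/2}`–BMO mean-oscillation bound instead).  HONEST FRAMING: a reduction between statements
about hypothetical ancient fields; nothing about Navier–Stokes regularity is proved and no summit is proved by a line. [folklore]
-/

namespace Summit.NavierStokesRegularity.NavierStokesRegularity.Theses.ExtremiserTransience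
set_option linter.dupNamespace false

open MeasureTheory Filter

/-- **27823 from a subcubic local energy budget**: if every member of the weak one-slice class satisfies `∫_{B(0,ρ)} ‖W t₀‖² ≤ C ρ^α` for `ρ ≥ 1`
with some `α < 3` (and `C`, `α` depending on `W, K, t₀`), then `PlateauSliceRigidity` holds (`c ρ³ ≤ C ρ^α` fails for large `ρ`). [folklore] -/
theorem plateauSliceRigidity_of_subcubicBudget
    (hB : ∀ (W : ℝ → EuclideanSpace ℝ (Fin 3) → EuclideanSpace ℝ (Fin 3)) (K t₀ : ℝ),
      ContinuousOn (Function.uncurry W) (Set.Iio (0 : ℝ) ×ˢ Set.univ) →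
      (∀ s t : ℝ, s < t → t < 0 → ∀ x, W t x =
        Literature.Analysis.FluidPDE.heatFlow (W s) (t - s) x - Literature.Analysis.FluidPDE.oseenDuhamel 1 s W W t x) →
      (∀ t : ℝ, t < 0 → ∀ x, Real.sqrt (-t) * ‖W t x‖ ≤ K) → t₀ < 0 →
      ∃ C α : ℝ, α < 3 ∧ ∀ ρ : ℝ, 1 ≤ ρ →
        ∫ y in Metric.ball (0 : EuclideanSpace ℝ (Fin 3)) ρ, ‖W t₀ y‖ ^ 2 ≤ C * ρ ^ α) :
    PlateauSliceRigidity := by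
  rintro ⟨W, K, t₀, m, hcont, hmild, hdec, ht0, hm, hle, hvol⟩
  have hconst := Theorems.ExtremiserTransience.sliceConstantSpeed W K t₀ m hcont hmild hdec ht0 hm hle hvol
  obtain ⟨C, α, hα, hC⟩ := hB W K t₀ hcont hmild hdec ht0
  obtain ⟨c, hc, hcρ⟩ := Theorems.ExtremiserTransience.ballMassLower W t₀ m hm hconst
  have key : ∀ ρ : ℝ, 1 ≤ ρ → c * ρ ^ (3 - α) ≤ C := by
    intro ρ hρ
    have hρ0 : 0 < ρ := lt_of_lt_of_le one_pos hρ
    have h1 : c * ρ ^ 3 ≤ C * ρ ^ α := (hcρ ρ hρ).trans (hC ρ hρ)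
    have hρα : 0 < ρ ^ α := Real.rpow_pos_of_pos hρ0 α
    have e : ρ ^ (3 : ℕ) = ρ ^ α * ρ ^ (3 - α) := by
      rw [← Real.rpow_natCast, ← Real.rpow_add hρ0]
      norm_num
    rw [e] at h1
    have h2 : (c * ρ ^ (3 - α)) * ρ ^ α ≤ C * ρ ^ α := by
      calc (c * ρ ^ (3 - α)) * ρ ^ α = c * (ρ ^ α * ρ ^ (3 - α)) := by ring
        _ ≤ C * ρ ^ α := h1
    exact le_of_mul_le_mul_right h2 hρα
  have hlim : Tendsto (fun ρ : ℝ => c * ρ ^ (3 - α)) atTop atTop :=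
    (tendsto_rpow_atTop (by linarith)).const_mul_atTop hc
  obtain ⟨ρ, hρ1, hρC⟩ := ((eventually_ge_atTop (1 : ℝ)).and (hlim.eventually_gt_atTop C)).exists
  exact absurd (key ρ hρ1) (not_le.2 hρC)

/-- The `ρ²`-budget form (p636343) is the case `α = 2` — recorded so that either budget closes 27823. [folklore] -/
theorem plateauSliceRigidity_of_budget'
    (hB : ∀ (W : ℝ → EuclideanSpace ℝ (Fin 3) → EuclideanSpace ℝ (Fin 3)) (K t₀ : ℝ),
      ContinuousOn (Function.uncurry W) (Set.Iio (0 : ℝ) ×ˢ Set.univ) →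
      (∀ s t : ℝ, s < t → t < 0 → ∀ x, W t x =
        Literature.Analysis.FluidPDE.heatFlow (W s) (t - s) x - Literature.Analysis.FluidPDE.oseenDuhamel 1 s W W t x) →
      (∀ t : ℝ, t < 0 → ∀ x, Real.sqrt (-t) * ‖W t x‖ ≤ K) → t₀ < 0 →
      ∃ C : ℝ, ∀ ρ : ℝ, 1 ≤ ρ → ∫ y in Metric.ball (0 : EuclideanSpace ℝ (Fin 3)) ρ, ‖W t₀ y‖ ^ 2 ≤ C * ρ ^ (5 / 2 : ℝ)) :
    PlateauSliceRigidity :=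
  plateauSliceRigidity_of_subcubicBudget fun W K t₀ hcont hmild hdec ht0 => by
    obtain ⟨C, hC⟩ := hB W K t₀ hcont hmild hdec ht0
    exact ⟨C, 5 / 2, by norm_num, hC⟩

end Summit.NavierStokesRegularity.NavierStokesRegularity.Theses.ExtremiserTransience
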